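import Summits.QuantumFields.YangMills.Theorems.UnitScaleTiltProp7TwistedIntertwining
import Summits.QuantumFields.YangMills.Theorems.UnitScaleTiltProp7SectET3CombLettersT3
import Summits.QuantumFields.YangMills.Theorems.UnitScaleTiltProp7LandauDictT3
import Summits.QuantumFields.YangMills.Theorems.UnitScaleTiltProp7RieszTauFrobNormT3
import Summits.QuantumFields.YangMills.Theorems.UnitScaleTiltProp7DbarTwWindow
import Literature.MathematicalPhysics.QuantumFieldTheory.Balaban1983to89.T3PrintedMinimiserExistence
import HarnessLib

/-!
# Route `UnitScaleTilt`, crux K1 «MinimiserStabilityRegPr» (stmt-QuantumFields-19200) — LANE II «DIVERGENCE RECOVERY AT CURVED `W`» (★★OWNER RULING №23), brick (B3),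
# rows (B3a)∕(B3b): **THE INTERTWINING ROWS OF ★p1 g19's `coarseCalculus_package` (skeleton v1.3 §3), WITH THE EXPLICIT COARSE TRANSPORTER `T := D̄_GL(W♭)∘(bondShift)⁻¹`
# AND NO DEFECT (`C3 = 0`)** — [Balaban1985BackgroundPropagators] (3.114)–(3.115) p. 418 in the route's `L²` letters

Cell `ym3-torus` ∕ width seat `ym-ust-19200-w1` (gen 15).  THEOREMS ONLY (0 `def`, 0 `sorry`); `--supports stmt-QuantumFields-19200 --as helper`, count-neutral.
YM₃ on T³ is a ladder rung (R3), not d = 4, not infinite volume, not the Clay problem; nothing here claims the stub, the crux, `hN06`, (V3) or the mass gap.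

THE PRINT.  [Balaban1985BackgroundPropagators] (3.114)–(3.115) p. 418 «(QD^{L⁻¹}λ)(c) = R̄_c(Q′λ)(c₊) − (Q′λ)(c₋) = (D_ŪQ′λ)(c) … Q_jDλ = D̄ʲQ′_jλ»; (3.14)–(3.19) p. 393 (the scaled
`L²` spaces on `T^{(j)}`, weights `ηʲ⁻ᵈ`-type); [Balaban1985Variational] (44) p. 285 (unitary transporters conjugate isometrically).

WHAT IS PROVED (ns `…Theorems.Prop7TwistedIntertwining`, continued).
* `norm_sq_toL2B` — `‖toL2B B‖² = cB·Σ_c ‖B c‖_F²`.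
* ★★★`intertwining_rows` — shape `∀ L, 1 < L → ∃ C3 e3, 0 ≤ C3 ∧ 0 < e3 ∧ ∀ F, F.L = L → ∀ n K (hnK : n < K) e, 0 ≤ e → e ≤ e3 → ∀ W, RegPr F n K e W → (unitarity) ∧ (B3a) ∧ (B3b)`
  with `C3 := 0`, `e3 := min (10⁷L³)⁻¹ (min (6·C0 3)⁻¹ (c2′ 3 L∕8))` and the transporter written out, `T c := descendToGL F n K hnK.le (bgUnits F K W) ((bondShift (sites_eq F n K hnK.le)).symm c)`:
  `T c ∈ U1` (✓`Prop7DbarTwWindow.descendToGL_bgUnits_mem_specialUnitaryUnits_of_regPr`); (B3a) `cB·Σ_c ‖conjR (T c) (Q′l c₊) − Q′l c₋‖² ≤ 2‖Qkc W (DL2 W l)‖² + 0`;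
  (B3b) `‖Qkc W (DL2 W l)‖² ≤ 2·(cB·Σ_c ‖conjR (T c) (Q′l c₊) − Q′l c₋‖²) + 0`, `Q′ = QprimeCombL2 F n K (c₀ L) W`, for EVERY `l : SiteL2K` — the two sums are term for term
  the same (`Qkc W (DL2 W l) = −toL2B (D̄_T(Q′l))` EXACTLY, by ✓`QTw_gaugeDir_eq_coarseGaugeDir_Qprime` of the parent file, ✓`Qkc_toL2`, ✓`DL2_toL2S_eq_covDerivFwdT`,
  `bondShift_tgt`), once in the Frobenius norm of the fibre `W₂` and once in the operator norm of `M₂(ℂ)`; the factor `2` is `‖X‖ ≤ ‖X‖_F ≤ √2‖X‖` (✓`Prop7RieszTauFrobNorm`).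
* §4 (pure append, ★p1 g19 NAMER WORD №11 (3) «(B3a-loc)»): `exists_window` (the window `e3` of record), ★★`fibre_Qkc_DL2_eq` (THE FIBREWISE EXACT IDENTITY
  `fibre_c (Qkc W (DL2 W l)) = frobEquiv⁻¹ (Ad(T c)(Q′l c₊) − Q′l c₋)` — (3.114) bond by bond), ★★★`intertwining_rows_on` ((B3a) with `Σ_{c∈S}` on BOTH sides, any `S`, `C3 = 0`).
HONEST SCOPE.  This is rows (B3a)(B3b) with the transporter EXPLICIT (an `∃ T` packaging is one `exact ⟨_, …⟩` away); (B3c) (closeness of `T` to the straight comb transport) is NOT in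
this file.  Rung R3, not Clay; YM gap NOT proved.

References: T. Bałaban, CMP **99** (1985) 389–434 [Balaban1985BackgroundPropagators]; CMP **98** (1985) 17–51 [Balaban1985Averaging]; CMP **102** (1985) 277–309 [Balaban1985Variational].
-/

set_option autoImplicit false

noncomputable section

open scoped Matrix.Norms.L2Operator

namespace Summit.QuantumFields.YangMills.Theorems.Prop7TwistedIntertwining

open Literature.MathematicalPhysics.QuantumFieldTheory.Balaban1983to89
open Literature.MathematicalPhysics.QuantumFieldTheory.Balaban1983to89.T3ContinuumYM3Torus
open B7Prop2Explicit (C0 c2')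
open B7Eq78Linearization (QprimeIter zdBlocking)
open B8Eq119TwistedAxial (bgT)
open T3PrintedRegularMinimiser (RegPr)
open T3LevelShift (siteShift bondShift bondShift_src bondShift_dir bondShift_tgt)
open T3PrintedRegularOrbits (sites_eq)
open T3SectALandauChart (bgUnits eta eta_pos covDerivFwdT)
open B10Eq27TorusAxialLog (pull transl)
open T4TermwiseTorus (tlift)
open B9Eq311L2Pairing (WL2)
open B11Eq103H1Complex (SiteL2K BondL2K)
open B7Prop1Explicit (U1)
open B7Prop2SpecialUnitary (specialUnitaryUnits specialUnitaryUnits_le_U1)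
open Summit.QuantumFields.YangMills.Theorems.Prop7SPrint (basePt)
open Summit.QuantumFields.YangMills.Theorems.Prop7SymAvgGL (descendToGL)
open Summit.QuantumFields.YangMills.Theorems.Prop7SymAvgTw (coordT3 coordT3_apply)
open Summit.QuantumFields.YangMills.Theorems.Prop7SectET3Transport (periodsT3)
open Summit.QuantumFields.YangMills.Theorems.Prop7SectET3HilbertLetters (W₂ frobEquiv toL2 toL2S toL2B DL2 toL2B_apply)
open Summit.QuantumFields.YangMills.Theorems.Prop7SectET3CombLetters (Qkc Qkc_toL2)
open Summit.QuantumFields.YangMills.Theorems.Prop7QprimeCombL2 (QprimeCombL2 QprimeCombL2_apply)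
open Summit.QuantumFields.YangMills.Theorems.Prop7LandauDict (DL2_toL2S_eq_covDerivFwdT)
open Summit.QuantumFields.YangMills.Theorems.Prop7RieszTauFrobNorm (norm_le_norm_frobEquiv_symm norm_frobEquiv_symm_le)
open Summit.QuantumFields.YangMills.Theorems.Prop7DbarTwWindow (descendToGL_bgUnits_mem_specialUnitaryUnits_of_regPr)

/-! ## §3 The rows (B3a)∕(B3b) of ★p1 g19's `coarseCalculus_package`, `T := descendToGL W`, `C3 = 0` -/

section Rows

variable (c₀ cB : ℕ → ℝ) [hc₀ : ∀ L : ℕ, Fact (0 < c₀ L)] [hcB : ∀ L : ℕ, Fact (0 < cB L)]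

/-- The norm of a coarse block field in `L²(cB)` is the `cB`-weighted FROBENIUS sum. [cite: Balaban1985BackgroundPropagators, (3.16) p.393] -/
theorem norm_sq_toL2B (F : T3Family) (n : ℕ) (cB' : ℝ) [Fact (0 < cB')] (B : PBond (F.P n) 0 → Matrix (Fin 2) (Fin 2) ℂ) :
    ‖toL2B F n cB' B‖ ^ 2 = cB' * ∑ c : PBond (F.P n) 0, ‖(frobEquiv.symm (B c) : W₂)‖ ^ 2 := by
  rw [WL2.norm_sq, Finset.mul_sum]
  exact Finset.sum_congr rfl fun c _ => by rw [toL2B_apply]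

/-- ★★★ **(B3a)∕(B3b) — THE INTERTWINING ROWS OF THE COARSE CALCULUS PACKAGE, WITH `T := D̄_GL(W♭)` AND NO DEFECT (`C3 = 0`)**, shape `∀ L ∃ C3 e3 ∀ F n K e W λ`: on `RegPr F n K e W`,
`e ≤ e3(L)`, the coarse transporter `T c := descendToGL W ((bondShift)⁻¹ c)` is unitary and, for every gauge parameter `λ`,
`cB·Σ_c ‖Ad(T c)(Q′λ)(c₊) − (Q′λ)(c₋)‖² ≤ 2‖Qkc W (DL2 W λ)‖²` and `‖Qkc W (DL2 W λ)‖² ≤ 2·cB·Σ_c ‖…‖²` (`Q′ = QprimeCombL2 W`): by §2 `Qkc W (DL2 W λ) = −toL2B(D̄_T(Q′λ))`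
EXACTLY, so both sides are the same `cB`-weighted sum, once in the Frobenius norm of the fibre `W₂` and once in the operator norm of `M₂(ℂ)` (`‖X‖ ≤ ‖X‖_F ≤ √2‖X‖`).
[cite: Balaban1985BackgroundPropagators, (3.114)–(3.115) p.418, (3.14)–(3.19) p.393; Balaban1985Variational, (44) p.285] -/
theorem intertwining_rows : ∀ (L : ℕ), 1 < L → ∃ C3 e3 : ℝ, 0 ≤ C3 ∧ 0 < e3 ∧
    ∀ (F : T3Family), F.L = L → ∀ (n K : ℕ) (hnK : n < K) (e : ℝ), 0 ≤ e → e ≤ e3 →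
      ∀ (W : GaugeField (F.P K) 0 (Matrix.specialUnitaryGroup (Fin 2) ℂ)), RegPr F n K e W →
        (∀ c : PBond (F.P K) (K - n), descendToGL F n K hnK.le (bgUnits F K W) ((bondShift (sites_eq F n K hnK.le)).symm c) ∈ U1 (Matrix (Fin 2) (Fin 2) ℂ)) ∧
        (∀ l : SiteL2K ℂ 3 (periodsT3 F K) (c₀ F.L) W₂,
          cB F.L * ∑ c : PBond (F.P K) (K - n), ‖B7Eq78Linearization.conjR (descendToGL F n K hnK.le (bgUnits F K W) ((bondShift (sites_eq F n K hnK.le)).symm c))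
              (QprimeCombL2 F n K (c₀ F.L) W l (c.src.shift c.dir)) - QprimeCombL2 F n K (c₀ F.L) W l c.src‖ ^ 2
            ≤ 2 * ‖Qkc F n K hnK.le (c₀ F.L) (cB F.L) W (DL2 F n K (c₀ F.L) W l)‖ ^ 2 + C3 * e ^ 2 * ((((F.L : ℝ) ^ (K - n)) ^ 3)⁻¹ * ‖l‖ ^ 2)) ∧
        (∀ l : SiteL2K ℂ 3 (periodsT3 F K) (c₀ F.L) W₂,
          ‖Qkc F n K hnK.le (c₀ F.L) (cB F.L) W (DL2 F n K (c₀ F.L) W l)‖ ^ 2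
            ≤ 2 * (cB F.L * ∑ c : PBond (F.P K) (K - n), ‖B7Eq78Linearization.conjR (descendToGL F n K hnK.le (bgUnits F K W) ((bondShift (sites_eq F n K hnK.le)).symm c))
              (QprimeCombL2 F n K (c₀ F.L) W l (c.src.shift c.dir)) - QprimeCombL2 F n K (c₀ F.L) W l c.src‖ ^ 2)
              + C3 * e ^ 2 * ((((F.L : ℝ) ^ (K - n)) ^ 3)⁻¹ * ‖l‖ ^ 2)) := by
  intro L hL
  have hC0 := B7Prop2Explicit.C0_pos 3
  have hc2 := B7Prop2Explicit.c2'_pos 3 L (by omega)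
  have hL3 : (0 : ℝ) < (10 : ℝ) ^ 7 * (L : ℝ) ^ 3 := by positivity
  obtain ⟨e3, he3⟩ : ∃ e3 : ℝ, e3 = min (1 / (10 ^ 7 * (L : ℝ) ^ 3)) (min (1 / (6 * C0 3)) (c2' 3 L / 8)) := ⟨_, rfl⟩
  have he3pos : 0 < e3 := by rw [he3]; exact lt_min (by positivity) (lt_min (by positivity) (by positivity))
  have hw1 : 10 ^ 7 * (L : ℝ) ^ 3 * e3 ≤ 1 := by
    have h1 : e3 ≤ 1 / (10 ^ 7 * (L : ℝ) ^ 3) := by rw [he3]; exact min_le_left _ _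
    rwa [le_div_iff₀ hL3, mul_comm] at h1
  have hw3 : C0 3 * (2 * e3) ≤ 1 / 3 := by
    have h1 : e3 ≤ 1 / (6 * C0 3) := by rw [he3]; exact (min_le_right _ _).trans (min_le_left _ _)
    have h2 : C0 3 * e3 ≤ C0 3 * (1 / (6 * C0 3)) := mul_le_mul_of_nonneg_left h1 hC0.le
    have h4 : C0 3 * (1 / (6 * C0 3)) = 1 / 6 := by field_simp
    linarith
  have hw4 : 4 * (2 * e3) ≤ c2' 3 L := by
    have h1 : e3 ≤ c2' 3 L / 8 := by rw [he3]; exact (min_le_right _ _).trans (min_le_right _ _)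
    linarith
  have hwexp : Real.exp (4 * (800 * (((3 : ℕ) : ℝ) + 1) ^ 2 * (((3 : ℕ) : ℝ) + 4)) * (2 * e3)) < 2 := by
    have hL2 : (2 : ℝ) ≤ L := by exact_mod_cast hL
    have hL8 : (8 : ℝ) ≤ (L : ℝ) ^ 3 := by nlinarith [pow_le_pow_left₀ (by norm_num : (0:ℝ) ≤ 2) hL2 3]
    have he : e3 ≤ 1 / (10 ^ 7 * (L : ℝ) ^ 3) := by rw [he3]; exact min_le_left _ _
    have he' : e3 ≤ 1 / (10 ^ 7 * 8) := he.trans (div_le_div_of_nonneg_left zero_le_one (by norm_num) (by nlinarith))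
    have hx : 4 * (800 * (((3 : ℕ) : ℝ) + 1) ^ 2 * (((3 : ℕ) : ℝ) + 4)) * (2 * e3) ≤ 1 / 2 := by
      norm_num at he' ⊢; linarith
    calc Real.exp _ ≤ Real.exp (1 / 2) := Real.exp_le_exp.2 hx
      _ < 2 := by
        have h9 := Real.exp_one_lt_d9
        have hsq : Real.exp (1 / 2) ^ 2 = Real.exp 1 := by rw [← Real.exp_nat_mul]; norm_num
        nlinarith [Real.exp_pos (1 / 2 : ℝ)]
  refine ⟨0, e3, le_rfl, he3pos, ?_⟩
  intro F hF n K hnK e he hle W hreg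
  subst hF
  have hreg' : RegPr F n K e3 W := T3PrintedMinimiserExistence.regPr_mono F hle hreg
  have hd : (F.P K).d = 3 := T3Family.P_d F K
  have hw3' : C0 (F.P K).d * (2 * e3) ≤ 1 / 3 := by rw [hd]; exact hw3
  have hw4' : 4 * (2 * e3) ≤ c2' (F.P K).d (F.P K).L := by rw [hd]; exact hw4
  have hwexp' : Real.exp (4 * (800 * (((F.P K).d : ℝ) + 1) ^ 2 * (((F.P K).d : ℝ) + 4)) * (2 * e3)) < 2 := by rw [hd]; exact hwexp
  -- the transporter
  have hT : ∀ c : PBond (F.P K) (K - n), descendToGL F n K hnK.le (bgUnits F K W) ((bondShift (sites_eq F n K hnK.le)).symm c) ∈ U1 (Matrix (Fin 2) (Fin 2) ℂ) :=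
    fun c => specialUnitaryUnits_le_U1 (descendToGL_bgUnits_mem_specialUnitaryUnits_of_regPr F hnK.le he3pos hw1 W hreg' _)
  -- the EXACT identity `‖Qkc W (DL2 W l)‖² = cB·Σ_c ‖D̄_T(Q′l)(c)‖_F²`
  have key : ∀ l : SiteL2K ℂ 3 (periodsT3 F K) (c₀ F.L) W₂,
      ‖Qkc F n K hnK.le (c₀ F.L) (cB F.L) W (DL2 F n K (c₀ F.L) W l)‖ ^ 2
        = cB F.L * ∑ c : PBond (F.P K) (K - n), ‖(frobEquiv.symm (B7Eq78Linearization.conjR (descendToGL F n K hnK.le (bgUnits F K W) ((bondShift (sites_eq F n K hnK.le)).symm c))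
              (QprimeCombL2 F n K (c₀ F.L) W l (c.src.shift c.dir)) - QprimeCombL2 F n K (c₀ F.L) W l c.src) : W₂)‖ ^ 2 := by
    intro l
    obtain ⟨lam, rfl⟩ : ∃ lam, l = toL2S F K (c₀ F.L) lam := ⟨(toL2S F K (c₀ F.L)).symm l, ((toL2S F K (c₀ F.L)).apply_symm_apply l).symm⟩
    -- `DL2 W (toL2S λ) = toL2 (−η⁻¹ • gaugeDir λ)`
    have hD : DL2 F n K (c₀ F.L) W (toL2S F K (c₀ F.L) lam)
        = toL2 F K (c₀ F.L) ((-(((eta F n K : ℝ) : ℂ)⁻¹)) • fun b : PBond (F.P K) 0 =>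
            lam b.src - ((bgUnits F K W b : (Matrix (Fin 2) (Fin 2) ℂ)ˣ) : Matrix (Fin 2) (Fin 2) ℂ) * lam b.tgt
              * (((bgUnits F K W b)⁻¹ : (Matrix (Fin 2) (Fin 2) ℂ)ˣ) : Matrix (Fin 2) (Fin 2) ℂ)) := by
      apply (toL2 F K (c₀ F.L)).symm.injective
      rw [LinearEquiv.symm_apply_apply]
      funext b
      rw [DL2_toL2S_eq_covDerivFwdT, Pi.smul_apply, covDerivFwdT, ← Complex.coe_smul, Complex.ofReal_inv, neg_smul, ← smul_neg, neg_sub,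
        B7Eq78Linearization.conjR_apply]
      rfl
    have hQ := QTw_gaugeDir_eq_coarseGaugeDir_Qprime F hnK.le he3pos hw1 hw3' hw4' hwexp' W hreg' lam
    rw [hD, Qkc_toL2, map_smul, hQ, map_smul, smul_smul, mul_neg, mul_inv_cancel₀ (by exact_mod_cast (eta_pos F n K).ne'), neg_one_smul, norm_neg, norm_sq_toL2B]
    refine congrArg _ (Fintype.sum_equiv (bondShift (sites_eq F n K hnK.le)) _ _ fun c : PBond (F.P n) 0 => ?_)
    rw [Equiv.symm_apply_apply, QprimeCombL2_apply, QprimeCombL2_apply, LinearEquiv.symm_apply_apply, B7Eq78Linearization.conjR_apply, ← norm_neg, ← map_neg,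
      neg_sub]
    -- `coordT3 (c₊) = tlift (c̃₊)`, `c̃ = bondShift c` (`bondShift_tgt`), in the skeleton's letters (`F.P`, not `F.PP`)
    have htgt : coordT3 F n K hnK.le c.tgt = tlift (((bondShift (sites_eq F n K hnK.le) : PBond (F.P n) 0 ≃ PBond (F.P K) (K - n)) c).tgt) :=
      congrArg tlift (bondShift_tgt (sites_eq F n K hnK.le) c).symm
    rw [htgt]
    rfl
  refine ⟨hT, fun l => ?_, fun l => ?_⟩
  · rw [key l, zero_mul, zero_mul, add_zero]
    have hcB' : 0 < cB F.L := (hcB F.L).out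
    have h1 : cB F.L * ∑ c : PBond (F.P K) (K - n), ‖B7Eq78Linearization.conjR (descendToGL F n K hnK.le (bgUnits F K W) ((bondShift (sites_eq F n K hnK.le)).symm c))
              (QprimeCombL2 F n K (c₀ F.L) W l (c.src.shift c.dir)) - QprimeCombL2 F n K (c₀ F.L) W l c.src‖ ^ 2
        ≤ cB F.L * ∑ c : PBond (F.P K) (K - n), ‖(frobEquiv.symm (B7Eq78Linearization.conjR (descendToGL F n K hnK.le (bgUnits F K W) ((bondShift (sites_eq F n K hnK.le)).symm c))
              (QprimeCombL2 F n K (c₀ F.L) W l (c.src.shift c.dir)) - QprimeCombL2 F n K (c₀ F.L) W l c.src) : W₂)‖ ^ 2 :=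
      mul_le_mul_of_nonneg_left (Finset.sum_le_sum fun c _ => pow_le_pow_left₀ (norm_nonneg _) (norm_le_norm_frobEquiv_symm _) 2) hcB'.le
    have h2 : 0 ≤ cB F.L * ∑ c : PBond (F.P K) (K - n), ‖(frobEquiv.symm (B7Eq78Linearization.conjR (descendToGL F n K hnK.le (bgUnits F K W) ((bondShift (sites_eq F n K hnK.le)).symm c))
              (QprimeCombL2 F n K (c₀ F.L) W l (c.src.shift c.dir)) - QprimeCombL2 F n K (c₀ F.L) W l c.src) : W₂)‖ ^ 2 :=
      mul_nonneg hcB'.le (Finset.sum_nonneg fun c _ => by positivity)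
    linarith
  · rw [key l, zero_mul, zero_mul, add_zero, mul_left_comm]
    have hcB' : 0 < cB F.L := (hcB F.L).out
    refine mul_le_mul_of_nonneg_left ?_ hcB'.le
    rw [Finset.mul_sum]
    refine Finset.sum_le_sum fun c _ => ?_
    have h := pow_le_pow_left₀ (norm_nonneg _) (norm_frobEquiv_symm_le (B7Eq78Linearization.conjR (descendToGL F n K hnK.le (bgUnits F K W) ((bondShift (sites_eq F n K hnK.le)).symm c))
              (QprimeCombL2 F n K (c₀ F.L) W l (c.src.shift c.dir)) - QprimeCombL2 F n K (c₀ F.L) W l c.src)) 2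
    rw [mul_pow, Real.sq_sqrt (by norm_num : (0 : ℝ) ≤ 2)] at h
    exact h

/-! ## §4 (B3a-loc) — THE FIBREWISE IDENTITY AND THE ROW ON A SET OF COARSE BONDS (★p1 g19 NAMER WORD №11 (3): `h9` reads it on the inner coarse patch) -/

/-- **THE WINDOW OF RECORD** `e3(L) := min (10⁷L³)⁻¹ (min (6·C₀(3))⁻¹ (c₂′(3,L)∕8))`: positive, and it implies the four displayed windows of ✓`QTw_apply_eq_of_regPr`
(`10⁷L³e3 ≤ 1`, `C₀(3)·2e3 ≤ ⅓`, `4·2e3 ≤ c₂′(3,L)`, `exp(4·800·16·7·2e3) < 2`). [cite: Balaban1985Averaging, (52)–(53) p.26; Balaban1985RegularSpaces, (1.7) p.77] -/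
theorem exists_window (L : ℕ) (hL : 1 < L) : ∃ e3 : ℝ, 0 < e3 ∧ 10 ^ 7 * (L : ℝ) ^ 3 * e3 ≤ 1 ∧ C0 3 * (2 * e3) ≤ 1 / 3 ∧ 4 * (2 * e3) ≤ c2' 3 L ∧
    Real.exp (4 * (800 * (((3 : ℕ) : ℝ) + 1) ^ 2 * (((3 : ℕ) : ℝ) + 4)) * (2 * e3)) < 2 := by
  have hC0 := B7Prop2Explicit.C0_pos 3
  have hc2 := B7Prop2Explicit.c2'_pos 3 L (by omega)
  have hL3 : (0 : ℝ) < (10 : ℝ) ^ 7 * (L : ℝ) ^ 3 := by positivity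
  obtain ⟨e3, he3⟩ : ∃ e3 : ℝ, e3 = min (1 / (10 ^ 7 * (L : ℝ) ^ 3)) (min (1 / (6 * C0 3)) (c2' 3 L / 8)) := ⟨_, rfl⟩
  have he3pos : 0 < e3 := by rw [he3]; exact lt_min (by positivity) (lt_min (by positivity) (by positivity))
  have hw1 : 10 ^ 7 * (L : ℝ) ^ 3 * e3 ≤ 1 := by
    have h1 : e3 ≤ 1 / (10 ^ 7 * (L : ℝ) ^ 3) := by rw [he3]; exact min_le_left _ _
    rwa [le_div_iff₀ hL3, mul_comm] at h1
  have hw3 : C0 3 * (2 * e3) ≤ 1 / 3 := by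
    have h1 : e3 ≤ 1 / (6 * C0 3) := by rw [he3]; exact (min_le_right _ _).trans (min_le_left _ _)
    have h2 : C0 3 * e3 ≤ C0 3 * (1 / (6 * C0 3)) := mul_le_mul_of_nonneg_left h1 hC0.le
    have h4 : C0 3 * (1 / (6 * C0 3)) = 1 / 6 := by field_simp
    linarith
  have hw4 : 4 * (2 * e3) ≤ c2' 3 L := by
    have h1 : e3 ≤ c2' 3 L / 8 := by rw [he3]; exact (min_le_right _ _).trans (min_le_right _ _)
    linarith
  have hwexp : Real.exp (4 * (800 * (((3 : ℕ) : ℝ) + 1) ^ 2 * (((3 : ℕ) : ℝ) + 4)) * (2 * e3)) < 2 := by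
    have hL2 : (2 : ℝ) ≤ L := by exact_mod_cast hL
    have hL8 : (8 : ℝ) ≤ (L : ℝ) ^ 3 := by nlinarith [pow_le_pow_left₀ (by norm_num : (0:ℝ) ≤ 2) hL2 3]
    have he : e3 ≤ 1 / (10 ^ 7 * (L : ℝ) ^ 3) := by rw [he3]; exact min_le_left _ _
    have he' : e3 ≤ 1 / (10 ^ 7 * 8) := he.trans (div_le_div_of_nonneg_left zero_le_one (by norm_num) (by nlinarith))
    have hx : 4 * (800 * (((3 : ℕ) : ℝ) + 1) ^ 2 * (((3 : ℕ) : ℝ) + 4)) * (2 * e3) ≤ 1 / 2 := by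
      norm_num at he' ⊢; linarith
    calc Real.exp _ ≤ Real.exp (1 / 2) := Real.exp_le_exp.2 hx
      _ < 2 := by
        have h9 := Real.exp_one_lt_d9
        have hsq : Real.exp (1 / 2) ^ 2 = Real.exp 1 := by rw [← Real.exp_nat_mul]; norm_num
        nlinarith [Real.exp_pos (1 / 2 : ℝ)]
  exact ⟨e3, he3pos, hw1, hw3, hw4, hwexp⟩

omit hcB in
/-- ★★ **THE FIBREWISE EXACT IDENTITY**: at `RegPr F n K ε₀ W` inside the windows of ✓`QTw_apply_eq_of_regPr`, for every `l` and every coarse bond `c` the fibre of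
`Qkc W (DL2 W l)` at `c` (read through `bondShift⁻¹`) IS `frobEquiv⁻¹ (Ad(T c)(Q′l)(c₊) − (Q′l)(c₋))`, `T c = descendToGL W (bondShift⁻¹ c)`, `Q′ = QprimeCombL2 W` — the member's
(3.114) bond by bond, no defect. [cite: Balaban1985BackgroundPropagators, (3.114)–(3.115) p.418, (3.14)–(3.16) p.393] -/
theorem fibre_Qkc_DL2_eq (F : T3Family) {n K : ℕ} (hnK : n ≤ K) {ε₀ : ℝ} (hε₀ : 0 < ε₀) (hε : 10 ^ 7 * (F.L : ℝ) ^ 3 * ε₀ ≤ 1)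
    (hα3 : C0 (F.P K).d * (2 * ε₀) ≤ 1 / 3) (hα4 : 4 * (2 * ε₀) ≤ c2' (F.P K).d (F.P K).L)
    (hexp : Real.exp (4 * (800 * (((F.P K).d : ℝ) + 1) ^ 2 * (((F.P K).d : ℝ) + 4)) * (2 * ε₀)) < 2)
    (W : GaugeField (F.P K) 0 (Matrix.specialUnitaryGroup (Fin 2) ℂ)) (hreg : RegPr F n K ε₀ W)
    (l : SiteL2K ℂ 3 (periodsT3 F K) (c₀ F.L) W₂) (c : PBond (F.P K) (K - n)) :
    WL2.equiv ℂ (fun _ : PBond (F.P n) 0 => cB F.L) W₂ (Qkc F n K hnK (c₀ F.L) (cB F.L) W (DL2 F n K (c₀ F.L) W l)) ((bondShift (sites_eq F n K hnK)).symm c)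
      = frobEquiv.symm (B7Eq78Linearization.conjR (descendToGL F n K hnK (bgUnits F K W) ((bondShift (sites_eq F n K hnK)).symm c))
          (QprimeCombL2 F n K (c₀ F.L) W l (c.src.shift c.dir)) - QprimeCombL2 F n K (c₀ F.L) W l c.src) := by
  obtain ⟨lam, rfl⟩ : ∃ lam, l = toL2S F K (c₀ F.L) lam := ⟨(toL2S F K (c₀ F.L)).symm l, ((toL2S F K (c₀ F.L)).apply_symm_apply l).symm⟩
  -- `DL2 W (toL2S λ) = toL2 (−η⁻¹ • gaugeDir λ)`
  have hD : DL2 F n K (c₀ F.L) W (toL2S F K (c₀ F.L) lam)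
      = toL2 F K (c₀ F.L) ((-(((eta F n K : ℝ) : ℂ)⁻¹)) • fun b : PBond (F.P K) 0 =>
          lam b.src - ((bgUnits F K W b : (Matrix (Fin 2) (Fin 2) ℂ)ˣ) : Matrix (Fin 2) (Fin 2) ℂ) * lam b.tgt
            * (((bgUnits F K W b)⁻¹ : (Matrix (Fin 2) (Fin 2) ℂ)ˣ) : Matrix (Fin 2) (Fin 2) ℂ)) := by
    apply (toL2 F K (c₀ F.L)).symm.injective
    rw [LinearEquiv.symm_apply_apply]
    funext b
    rw [DL2_toL2S_eq_covDerivFwdT, Pi.smul_apply, covDerivFwdT, ← Complex.coe_smul, Complex.ofReal_inv, neg_smul, ← smul_neg, neg_sub,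
      B7Eq78Linearization.conjR_apply]
    rfl
  have hQ := QTw_gaugeDir_eq_coarseGaugeDir_Qprime F hnK hε₀ hε hα3 hα4 hexp W hreg lam
  rw [hD, Qkc_toL2, map_smul (Summit.QuantumFields.YangMills.Theorems.Prop7SymAvgTw.QTw F n K hnK W), hQ, map_smul (toL2B F n (cB F.L)), smul_smul, mul_neg,
    mul_inv_cancel₀ (by exact_mod_cast (eta_pos F n K).ne'), WL2.equiv_smul, Pi.smul_apply, toL2B_apply, neg_one_smul, ← map_neg, neg_sub, QprimeCombL2_apply,
    QprimeCombL2_apply, LinearEquiv.symm_apply_apply, B7Eq78Linearization.conjR_apply]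
  -- read the base points: `coordT3 (bondShift⁻¹ c)₋ = tlift c₋`, `coordT3 (bondShift⁻¹ c)₊ = tlift (c₋.shift c.dir)`
  have h1 : coordT3 F n K hnK (((bondShift (sites_eq F n K hnK)).symm c : PBond (F.P n) 0)).src = tlift c.src :=
    congrArg tlift ((siteShift (sites_eq F n K hnK)).apply_symm_apply c.src)
  have h2 : coordT3 F n K hnK (((bondShift (sites_eq F n K hnK)).symm c : PBond (F.P n) 0)).tgt = tlift (c.src.shift c.dir) := by
    show tlift (siteShift (sites_eq F n K hnK) ((((siteShift (sites_eq F n K hnK)).symm c.src)).shift c.dir)) = _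
    rw [T3LevelShift.siteShift_shift, Equiv.apply_symm_apply]
    rfl
  rw [h1, ← h2]
  rfl

/-- ★★★ **(B3a-loc) — THE INTERTWINING ROW ON AN ARBITRARY SET OF COARSE BONDS** (shape (R1), `C3 = 0`, window `e3` of `intertwining_rows`): on `RegPr F n K e W`, `e ≤ e3(L)`,
for every finite set `S` of coarse bonds and every `l`,
`cB·Σ_{c∈S} ‖Ad(T c)(Q′l c₊) − Q′l c₋‖² ≤ 2·(cB·Σ_{c∈S} ‖fibre_c (Qkc W (DL2 W l))‖²) + C3·e²·ℓ⁻³‖l‖²` — `h9` of the (REC) member core reads it on the inner patch.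
[cite: Balaban1985BackgroundPropagators, (3.114)–(3.115) p.418, (3.16) p.393] -/
theorem intertwining_rows_on : ∀ (L : ℕ), 1 < L → ∃ C3 e3 : ℝ, 0 ≤ C3 ∧ 0 < e3 ∧
    ∀ (F : T3Family), F.L = L → ∀ (n K : ℕ) (hnK : n < K) (e : ℝ), 0 ≤ e → e ≤ e3 →
      ∀ (W : GaugeField (F.P K) 0 (Matrix.specialUnitaryGroup (Fin 2) ℂ)), RegPr F n K e W →
        ∀ (S : Finset (PBond (F.P K) (K - n))) (l : SiteL2K ℂ 3 (periodsT3 F K) (c₀ F.L) W₂),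
          cB F.L * ∑ c ∈ S, ‖B7Eq78Linearization.conjR (descendToGL F n K hnK.le (bgUnits F K W) ((bondShift (sites_eq F n K hnK.le)).symm c))
              (QprimeCombL2 F n K (c₀ F.L) W l (c.src.shift c.dir)) - QprimeCombL2 F n K (c₀ F.L) W l c.src‖ ^ 2
            ≤ 2 * (cB F.L * ∑ c ∈ S, ‖WL2.equiv ℂ (fun _ : PBond (F.P n) 0 => cB F.L) W₂
                (Qkc F n K hnK.le (c₀ F.L) (cB F.L) W (DL2 F n K (c₀ F.L) W l)) ((bondShift (sites_eq F n K hnK.le)).symm c)‖ ^ 2)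
              + C3 * e ^ 2 * ((((F.L : ℝ) ^ (K - n)) ^ 3)⁻¹ * ‖l‖ ^ 2) := by
  intro L hL
  obtain ⟨e3, he3pos, hw1, hw3, hw4, hwexp⟩ := exists_window L hL
  refine ⟨0, e3, le_rfl, he3pos, ?_⟩
  intro F hF n K hnK e he hle W hreg S l
  subst hF
  have hreg' : RegPr F n K e3 W := T3PrintedMinimiserExistence.regPr_mono F hle hreg
  have hd : (F.P K).d = 3 := T3Family.P_d F K
  have hw3' : C0 (F.P K).d * (2 * e3) ≤ 1 / 3 := by rw [hd]; exact hw3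
  have hw4' : 4 * (2 * e3) ≤ c2' (F.P K).d (F.P K).L := by rw [hd]; exact hw4
  have hwexp' : Real.exp (4 * (800 * (((F.P K).d : ℝ) + 1) ^ 2 * (((F.P K).d : ℝ) + 4)) * (2 * e3)) < 2 := by rw [hd]; exact hwexp
  have hcB' : 0 < cB F.L := (hcB F.L).out
  rw [zero_mul, zero_mul, add_zero, mul_left_comm]
  refine mul_le_mul_of_nonneg_left ?_ hcB'.le
  rw [Finset.mul_sum]
  refine Finset.sum_le_sum fun c _ => ?_
  rw [fibre_Qkc_DL2_eq c₀ cB F hnK.le he3pos hw1 hw3' hw4' hwexp' W hreg' l c]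
  have h := pow_le_pow_left₀ (norm_nonneg _) (norm_le_norm_frobEquiv_symm (B7Eq78Linearization.conjR
    (descendToGL F n K hnK.le (bgUnits F K W) ((bondShift (sites_eq F n K hnK.le)).symm c))
    (QprimeCombL2 F n K (c₀ F.L) W l (c.src.shift c.dir)) - QprimeCombL2 F n K (c₀ F.L) W l c.src)) 2
  nlinarith [norm_nonneg ((frobEquiv.symm (B7Eq78Linearization.conjR
    (descendToGL F n K hnK.le (bgUnits F K W) ((bondShift (sites_eq F n K hnK.le)).symm c))
    (QprimeCombL2 F n K (c₀ F.L) W l (c.src.shift c.dir)) - QprimeCombL2 F n K (c₀ F.L) W l c.src)) : W₂)]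

end Rows

end Summit.QuantumFields.YangMills.Theorems.Prop7TwistedIntertwining
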